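import Literature.NumberTheory.Rogawski1990.Ch4Sec10                        -- ★ §4.10 currency: `epsOrbitalIntegral`, `classEpsOrbitalIntegral`, `epsKappaOrbitalIntegral`, `TwistedTransferData`, `PhiEpsSt`, `IsStableMatch`
import Literature.NumberTheory.Rogawski1990.LocalDeltaTransferLeviStratum     -- ★ one-term engine `stableOrbitalIntegralRel_eq_classOrbitalIntegral_of_unique` (the untwisted side)
import HarnessLib

/-!
# R90 · S6 «Ch. 14.1–14.5 stable trace formula» — card TB2d (rows E1.4.4.2.4 ∕ .5), FILE A: THE ε-SPLIT (HYPERBOLIC-NORM) CLAUSE OF THE TWISTED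
# HECKE FUNDAMENTAL LEMMA (4.10.2) FROM VALUE BINDERS (`Theorems/R90S6TwistedHyperbolicHeckeFL.lean`)

Cell `hodgecm-mathlib`, crux H413 (`stmt-HodgeConjecture-24833`), route of record `HCCMUnconditional`; programme R90-TF (brief `director/R90-BRIEF.v2.md`
1f40d54518340a35), section S6 (base `R90-C14`, dealer R90-C14-plan (g2)), seat R90-C14-p04 (g2); CARD TB2d dealt BY NAME 2026-09-05T02:41:15Z (R90 bus) after the
TB2d-CENSUS 02:39:39Z («=» l.9913), HEADS 02:43:12Z.  Lane `--kind proof --supports stmt-HodgeConjecture-24833 --as helper`; THEOREMS ONLY over ★ carriers (no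
definition, no instance, no notation, no named fact, no kit, no `sorry`); imports = ★ `Rogawski1990.Ch4Sec10` + ★ `Rogawski1990.LocalDeltaTransferLeviStratum` + HarnessLib.

## THE PRINT
[Rogawski1990, §4.10 (4.10.1)–(4.10.2), Prop. 4.10.1 (a) pp. 57–58]: «`f` is a stable twisted transfer of `φ`» iff `Φ^st_ε(δ, φ) = Φ^st(γ, f)` for all ε-regular
semisimple `δ ∈ G̃` and `γ ∈ 𝒩(δ)`, where (4.10.1) `Φ^κ_ε(δ, φ) = Σ_{ν ∈ 𝒟_ε(δ∕F)} κ(ν) e(δ^ν) Φ_ε(δ^ν, φ)` and `Φ^st_ε` is the case `κ ≡ 1`; «if `E∕F` is unramified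
and `φ ∈ ℋ̃`, then (4.10.2) holds with `f = ψ̂_G(φ)`» (the fundamental lemma for base change, [BR₁]).  At an ε-SPLIT `δ` (norm `γ = Nδ` `G`-regular in the diagonal
Levi `M = E^× × E^1`, §4.11 p. 60 «`δ` such that `N(δ)` is hyperbolic») both sides are ONE term: on `G = U(3)` the stable class of a regular element of `M` is a single
conjugacy class (§3.5 Prop. 3.5.2; Lemma 4.9.2 p. 56), and on `G̃` exactly one ε-class `δ^ν` inside `𝒪_{ε-st}(δ)` meets the support of `φ = 𝟙_{K̃ϖ^λK̃}` (the
SELECTION RULE — ★ L2-sgn `twistedShell_eq_empty_of_not_even`, ★ K7 (K7.5)); the two surviving orbital integrals are then CONSTANT TERMS weighted by Weyl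
discriminants (Cartier, [CartierCorvallis1979, §IV (4.2) p. 146]; the ε-twisted unfolding = ★ TB2a 1b∕1c + TJ1), and the Satake isomorphism `ψ̂_G = b`
(★ W7-b, ★ TB3 `coeff_satakeTransform_bcGraphPartner`) identifies the two coefficient sums.

## WHAT THIS FILE PROVES (namespace `Summit.HodgeConjecture.HodgeConjecture.R90.S6`; the twisted twin of ★ F5 `R90S6HyperbolicHeckeFL` §1 + HEAD «from value binders»)
* (A.1) `epsKappaOrbitalIntegral_eq_mul_classEpsOrbitalIntegral_of_unique` — **(4.10.1) HAS ONE TERM UNDER A SELECTION**: in the abstract currency of ★ `Ch4Sec10`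
  (ANY `G̃`, `ε`, `Z′`, stable ε-class relation `stε`, class character `κ`, signs `e`, measure family `m`, test function `φ`): if `c₀ ⊂ 𝒪_{ε-st}(δ)` and every OTHER
  class `c ⊂ 𝒪_{ε-st}(δ)` has `Φ_ε(δ_c, φ; m_c) = 0`, then `Φ^κ_ε(δ, φ) = κ(δ, c₀) · e(δ_{c₀}) · Φ_ε(δ_{c₀}, φ; m_{c₀})` (`finsum` = one term; no finiteness needed).
* (A.2) `epsKappaOrbitalIntegral_one_eq_stableOrbitalIntegralRel_of_values` — **THE ε-SPLIT CLAUSE OF (4.10.2) FROM VALUE BINDERS** (both sides over abstract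
  carriers, so that every later value theorem plugs by instantiation): the selection (A.1) with `e(δ_{c₀}) = 1` (the ε-centralizer of an ε-split `δ` is the torus
  `M̃_{δε} ≅ M`, `e = 1`), the one-class binders of ★ `stableOrbitalIntegralRel_eq_classOrbitalIntegral_of_unique` on the `G`-side, the TWISTED VALUE
  `hTO : Φ_ε(δ_{c₀}, φ; m_{c₀}) = J · Σ` (the shape of TB2a FILE 2 `R90S6TwistedConstantTermValue` (p06): `J` = the ε-twisted unipotent Jacobian of ★ TJ1, `Σ` = the
  ε-norm-fibre cell sum over ★ TL4 (A.3)), the UNTWISTED VALUE `hΦG : Φ(⟦γ⟧, f) = (A · B)⁻¹ · W⁻¹ · S₃` (the shape of ★ B2a FILE 2 `classOrbitalIntegral_coeff_toVector_frame_eq`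
  ∕ ★ F5 HEAD binder `hΦG`: `A = ‖a − 1‖`, `B = √‖b − 1‖`, `W = w₃(ℓ³_m)`, `S₃ = (𝒮 f)_{ℓ³_m}`), and the SCALAR JUNCTION `hJS : J · Σ = (A · B)⁻¹ · W⁻¹ · S₃` (FILE B
  §3: TJ1's `J = |D_M(Nδ)|`-value against the cell weights, and ★ TB3: `S₃ = Σ_{μ₀−μ₂ = m}(𝒮^{GL}𝟙_λ)_μ`) ⟹ `Φ^{st}_ε(δ, φ) = Φ^{st}(γ, f)`.
* (A.3) `phiEpsSt_eq_stableOrbitalIntegralRel_of_values` — (A.2) read at a ★ `TwistedTransferData` `𝔡` (`stε = 𝔡.stEps`, `e = 𝔡.kottwitzSign`, `st = 𝔡.IsStConj`):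
  the `(δ, γ)`-clause of ★ `IsStableMatch 𝔡 mt mG φ f`, verbatim.

FILE B (`§3` scalar identity, `§4` the CONCRETE head at `G̃ = GL₃(E_w) ⊃ U(3)` binding p06's FILE 2 head bytes `hTOval`, ★ B2a FILE 2, ★ TJ1, and discharging
`hJS` by ★ TB3 + the (T4)↔(T6) coefficient seam) follows the posting of FILE 2's head (dealer l.9913).

HONEST LABEL: HC_CM is proved only modulo the 7 printed citations (2 remaining named inputs: hLiu418 = `stmt-HodgeConjecture-24832`, h413 =
`stmt-HodgeConjecture-24833`) until rung 0 closes; REL ≠ ★ ≠ BUILT.  This file is the COMPOSITION layer of rows E1.4.4.2.4 ∕ .5 over value binders; it discharges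
no named input and pays no socket by itself (the binders are paid by TB2a FILE 2, ★ TJ1, ★ B2a, ★ TB3, ★ L2-sgn ∕ K7).

## References
* [Rogawski1990] J. D. Rogawski, *Automorphic Representations of Unitary Groups in Three Variables*, Ann. of Math. Stud. 123 (1990), §1.6 pp. 5–6, §3.5
  Prop. 3.5.2, §3.11 pp. 34–35, §4.9 Lemma 4.9.2 p. 56, §4.10 (4.10.1)–(4.10.2), Prop. 4.10.1 (a) pp. 57–58, §4.11 p. 60.
* [CartierCorvallis1979] P. Cartier, *Representations of 𝔭-adic groups: a survey*, PSPM 33.1 (1979), §IV (4.2) p. 146.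
* [Kottwitz1986] R. Kottwitz, *Stable trace formula: elliptic singular terms*, Math. Ann. 275 (1986), §7 (one class on the Levi).
-/

set_option autoImplicit false
-- the mandated namespace repeats the single-problem summit's segment (`HodgeConjecture.HodgeConjecture`)
set_option linter.dupNamespace false

noncomputable section

open MeasureTheory
open Literature.NumberTheory.Rogawski1990 Literature.NumberTheory.Rogawski1990.Ch4Sec10 Literature.NumberTheory.Automorphic

namespace Summit.HodgeConjecture.HodgeConjecture.R90.S6

/-! ## §1 (4.10.1) has ONE term under a selection rule -/

section OneTerm

variable {Gt : Type*} [Group Gt] (ε : Gt →* Gt) {Z' : Subgroup Gt} [∀ δ : Gt, MeasurableSpace (Gt ⧸ epsCentralizer ε δ)]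

/-- **(A.1) (4.10.1) HAS ONE TERM UNDER A SELECTION.**  In the abstract currency of ★ `Ch4Sec10` (`Φ^κ_ε(δ, φ) = Σᶠ_{c ⊂ 𝒪_{ε-st}(δ)} κ(δ, c) · e(δ_c) ·
Φ_ε(δ_c, φ; m_c)`, classes modulo `Z′`, representatives `δ_c = out c`): if the class `c₀` lies in the stable ε-class of `δ` (`hc₀`) and every OTHER class there has
vanishing twisted orbital integral (`hsel` — for `φ = 𝟙_{K̃ϖ^λK̃}` the wrong-parity classes have empty twisted shell, ★ L2-sgn ∕ ★ K7), then
`Φ^κ_ε(δ, φ) = κ(δ, c₀) · e(δ_{c₀}) · Φ_ε(δ_{c₀}, φ; m_{c₀})` — the twisted twin of ★ `stableOrbitalIntegralRel_eq_classOrbitalIntegral_of_unique` (no finiteness of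
`𝒟_ε(δ∕F)` is needed: all other summands are `0`). [cite: Rogawski1990, §4.10 (4.10.1) p. 57; §3.11 p. 35] -/
theorem epsKappaOrbitalIntegral_eq_mul_classEpsOrbitalIntegral_of_unique (stε : Gt → Gt → Prop) (κ : Gt → EpsConjClassesMod ε Z' → ℂ) (e : Gt → ℂ)
    (m : EpsOrbitalMeasureFamily ε Z') (φ : Gt → ℂ) (δ : Gt) (c₀ : EpsConjClassesMod ε Z') (hc₀ : stε δ (Quotient.out c₀))
    (hsel : ∀ c : EpsConjClassesMod ε Z', stε δ (Quotient.out c) → c ≠ c₀ → classEpsOrbitalIntegral ε m φ c = 0) :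
    epsKappaOrbitalIntegral ε stε κ e m φ δ = κ δ c₀ * e (Quotient.out c₀) * classEpsOrbitalIntegral ε m φ c₀ := by
  unfold epsKappaOrbitalIntegral
  rw [finsum_mem_def, finsum_eq_single _ c₀ fun c hc => ?_]
  · exact Set.indicator_of_mem (show c₀ ∈ {c : EpsConjClassesMod ε Z' | stε δ (Quotient.out c)} from hc₀) _
  · by_cases hcS : c ∈ {c : EpsConjClassesMod ε Z' | stε δ (Quotient.out c)}
    · rw [Set.indicator_of_mem hcS, hsel c hcS hc, mul_zero]
    · exact Set.indicator_of_notMem hcS _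

/-- **(A.1′) the `κ ≡ 1` (stable) case with trivial sign: `Φ^{st}_ε(δ, φ) = Φ_ε(δ_{c₀}, φ; m_{c₀})`** when moreover `e(δ_{c₀}) = 1` (the ε-centralizer of an
ε-split `δ` is a torus, whose Kottwitz sign is `1`). [cite: Rogawski1990, §4.10 (4.10.1) p. 57; §4.1 (4.1.2) p. 40] -/
theorem epsKappaOrbitalIntegral_one_eq_classEpsOrbitalIntegral_of_unique (stε : Gt → Gt → Prop) (e : Gt → ℂ)
    (m : EpsOrbitalMeasureFamily ε Z') (φ : Gt → ℂ) (δ : Gt) (c₀ : EpsConjClassesMod ε Z') (hc₀ : stε δ (Quotient.out c₀))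
    (hsel : ∀ c : EpsConjClassesMod ε Z', stε δ (Quotient.out c) → c ≠ c₀ → classEpsOrbitalIntegral ε m φ c = 0)
    (he : e (Quotient.out c₀) = 1) :
    epsKappaOrbitalIntegral ε stε (fun _ _ => 1) e m φ δ = classEpsOrbitalIntegral ε m φ c₀ := by
  rw [epsKappaOrbitalIntegral_eq_mul_classEpsOrbitalIntegral_of_unique ε stε _ e m φ δ c₀ hc₀ hsel, he, mul_one, one_mul]

end OneTerm

/-! ## §2 The ε-split clause of (4.10.2) from value binders -/

section Values

variable {Gt : Type*} [Group Gt] (ε : Gt →* Gt) {Z' : Subgroup Gt} [∀ δ : Gt, MeasurableSpace (Gt ⧸ epsCentralizer ε δ)]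
  {G : Type*} [Group G] [∀ a : G, MeasurableSpace (G ⧸ Subgroup.centralizer ({a} : Set G))]

/-- **(A.2) THE ε-SPLIT (HYPERBOLIC-NORM) CLAUSE OF THE TWISTED FUNDAMENTAL LEMMA (4.10.2), FROM VALUE BINDERS.**  Over abstract carriers (`G̃` with `ε`,
classes modulo `Z′`, stable ε-class relation `stε`, signs `e`, twisted family `mt`, `φ : G̃ → ℂ`, `δ ∈ G̃`; `G` with stable conjugacy `st`, family `mG`, `f : G → ℂ`,
`γ ∈ G`): if (i) ONE ε-class `c₀ ⊂ 𝒪_{ε-st}(δ)` carries `φ` (`hc₀`, `hsel`) and `e(δ_{c₀}) = 1` (`he`); (ii) the stable class of `γ` is its conjugacy class (`hrefl`,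
`huniq` — on the Levi `M`, ★ `isConj_of_isLocalStablyConjH_of_levi` lineage); (iii) the TWISTED VALUE `Φ_ε(δ_{c₀}, φ; m_{c₀}) = J · Σ` (`hTO` — TB2a FILE 2's shape:
ε-twisted unipotent Jacobian `J` times the ε-norm-fibre cell sum `Σ`); (iv) the UNTWISTED VALUE `Φ(⟦γ⟧, f) = (A · B)⁻¹ · W⁻¹ · S₃` (`hΦG` — ★ B2a FILE 2's shape:
`A = ‖a − 1‖`, `B = √‖b − 1‖`, `W = w₃(ℓ³_m)`, `S₃` the Satake coefficient of `f` on the line `ℓ³_m`); (v) the SCALAR JUNCTION `J · Σ = (A · B)⁻¹ · W⁻¹ · S₃` (`hJS` —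
the Jacobian identity and the Satake identity `ψ̂_G = b`: `S₃ = Σ_{μ₀−μ₂=m}(𝒮^{GL}φ)_μ`, ★ TB3) — then `Φ^{st}_ε(δ, φ) = Φ^{st}(γ, f)`, the `(δ, γ)`-clause of (4.10.2).
[cite: Rogawski1990, §4.10 (4.10.1)–(4.10.2), Prop. 4.10.1 (a) pp. 57–58; §4.9 Lemma 4.9.2 p. 56] [cite: CartierCorvallis1979, §IV (4.2) p. 146] -/
theorem epsKappaOrbitalIntegral_one_eq_stableOrbitalIntegralRel_of_values (stε : Gt → Gt → Prop) (e : Gt → ℂ)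
    (mt : EpsOrbitalMeasureFamily ε Z') (φ : Gt → ℂ) (δ : Gt) (c₀ : EpsConjClassesMod ε Z') (hc₀ : stε δ (Quotient.out c₀))
    (hsel : ∀ c : EpsConjClassesMod ε Z', stε δ (Quotient.out c) → c ≠ c₀ → classEpsOrbitalIntegral ε mt φ c = 0)
    (he : e (Quotient.out c₀) = 1)
    (st : G → G → Prop) (mG : OrbitalMeasureFamily G) (f : G → ℂ) (γ : G)
    (hrefl : ∀ a' : G, IsConj γ a' → st γ a') (huniq : ∀ k : G, st γ k → IsConj γ k)
    {J S A B W S₃ : ℂ}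
    (hTO : classEpsOrbitalIntegral ε mt φ c₀ = J * S)
    (hΦG : classOrbitalIntegral mG f (ConjClasses.mk γ) = (A * B)⁻¹ * W⁻¹ * S₃)
    (hJS : J * S = (A * B)⁻¹ * W⁻¹ * S₃) :
    epsKappaOrbitalIntegral ε stε (fun _ _ => 1) e mt φ δ = stableOrbitalIntegralRel st mG f γ := by
  rw [epsKappaOrbitalIntegral_one_eq_classEpsOrbitalIntegral_of_unique ε stε e mt φ δ c₀ hc₀ hsel he, hTO, hJS,
    stableOrbitalIntegralRel_eq_classOrbitalIntegral_of_unique st mG f γ hrefl huniq, hΦG]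

/-- **(A.3) THE SAME CLAUSE AT A TWISTED TRANSFER DATUM** (★ `TwistedTransferData` `𝔡`: `stε = 𝔡.stEps`, `e = 𝔡.kottwitzSign`, `st = 𝔡.IsStConj`): under the
binders of (A.2), `Φ^{st}_ε(δ, φ) = Φ^{st}(γ, f)` in the letters of ★ `PhiEpsSt` ∕ ★ `stableOrbitalIntegralRel` — VERBATIM the `(δ, γ)`-clause of
★ `IsStableMatch 𝔡 mt mG φ f` («`f` is a stable twisted transfer of `φ`», (4.10.2)), to be fed the ε-regularity ∕ norm hypotheses by the assembling seat.
[cite: Rogawski1990, §4.10 Prop. 4.10.1 (a), (4.10.2) p. 58] -/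
theorem phiEpsSt_eq_stableOrbitalIntegralRel_of_values {Ht H CharM : Type*} [Group Ht] [Group H]
    (𝔡 : TwistedTransferData Gt G Ht H CharM ε Z') (mt : EpsOrbitalMeasureFamily ε Z') (mG : OrbitalMeasureFamily G)
    (φ : Gt → ℂ) (f : G → ℂ) (δ : Gt) (γ : G) (c₀ : EpsConjClassesMod ε Z') (hc₀ : 𝔡.stEps δ (Quotient.out c₀))
    (hsel : ∀ c : EpsConjClassesMod ε Z', 𝔡.stEps δ (Quotient.out c) → c ≠ c₀ → classEpsOrbitalIntegral ε mt φ c = 0)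
    (he : 𝔡.kottwitzSign (Quotient.out c₀) = 1)
    (hrefl : ∀ a' : G, IsConj γ a' → 𝔡.IsStConj γ a') (huniq : ∀ k : G, 𝔡.IsStConj γ k → IsConj γ k)
    {J S A B W S₃ : ℂ}
    (hTO : classEpsOrbitalIntegral ε mt φ c₀ = J * S)
    (hΦG : classOrbitalIntegral mG f (ConjClasses.mk γ) = (A * B)⁻¹ * W⁻¹ * S₃)
    (hJS : J * S = (A * B)⁻¹ * W⁻¹ * S₃) :
    𝔡.PhiEpsSt mt φ δ = stableOrbitalIntegralRel 𝔡.IsStConj mG f γ :=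
  epsKappaOrbitalIntegral_one_eq_stableOrbitalIntegralRel_of_values ε 𝔡.stEps 𝔡.kottwitzSign mt φ δ c₀ hc₀ hsel he 𝔡.IsStConj mG f γ hrefl huniq
    hTO hΦG hJS

end Values

end Summit.HodgeConjecture.HodgeConjecture.R90.S6
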